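import Summits.Ventures.PercRepro.MSTightExtSideMain
import Summits.Ventures.PercRepro.MSTightGenuineMembers
import Summits.Ventures.PercRepro.MSTightCoverTwinFree

/-!
# Theorem (i) TightExt in the row exception

Dossier proofs/MINE1-theoremS.md, Addendum 52 supplement 1 (the boundary case) and Addendum 54
supplement 3. `T = insert m K` is a tight one-point extension of a covering excess-one `K` in a
tight twin-free `P` without minimum or maximum member, and **no member of `K` contains the
addable part `R = Rstar T`** (the row exception of `extension_side_of_cover_of_Rstar`). Then
`R = m` is the maximum of `T`, every difference of `T` is `m \ t`, every `P₁`-eligible `p` lies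
inside `m`, and every member of `P` not inside `m` is `P₀`-eligible, so it contains the core of
`K` — which is therefore the core of `P`. For a `P₁`-eligible `p ∉ K` inside `m`: with an
element `a ∉ m` of `P` (no maximum member), either `a` is addable and `p ∪ {a}`, or `a` is
removable and `{a} ∪ (p ∩ Rstar P)`, is a member of `P` not inside `m`; its difference against the
co-singleton member `m.erase e ∈ K` (MaxErase) is `m \ t` for a member `t` of `T`, which turns
out to be `p` (resp. `p ∩ Rstar P`, and then `p ∈ T` by convexity). Hence `p = m`:
`extension_side_of_row`.
-/

namespace PercRepro.MSTight

open Finset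
open scoped FinsetFamily symmDiff

variable {α : Type*} [DecidableEq α] [Fintype α]

/-- **Theorem (i), the row exception.** -/
theorem extension_side_of_row {P K : Finset (Finset α)} {m : Finset α} (hP : Tight P)
    (htf : ∀ a b, Twin P a b → a = b) (hmin : ∀ t ∈ P, ∃ p ∈ P, ¬ t ⊆ p)
    (hmax : ∀ t ∈ P, ∃ p ∈ P, ¬ p ⊆ t) (hne : K.Nonempty)
    (hT : Tight (insert m K)) (hmP : m ∈ P)
    (hm1 : ∀ k ∈ K, m \ k ∈ K \\ K) (hm0 : ∀ k ∈ K, k \ m ∈ K \\ K)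
    (hcov : ∀ p ∈ P, p ∉ K → (∀ k ∈ K, p \ k ∈ K \\ K) ∨ (∀ k ∈ K, k \ p ∈ K \\ K))
    (hrow : ∀ k ∈ K, ¬ Rstar (insert m K) ⊆ k) :
    ∀ p ∈ P, p ∉ K → (∀ k ∈ K, p \ k ∈ K \\ K) → p = m := by
  set T := insert m K with hTdef
  set R := Rstar T with hR
  have hmT : m ∈ T := mem_insert_self m K
  have hRT : R ∈ T := Rstar_mem_of_dichotomy (dichotomy_of_tight hT) ⟨m, hmT⟩
  have hRm : R = m := by
    rcases mem_insert.1 hRT with h | h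
    · exact h
    · exact absurd (subset_refl R) (hrow R h)
  have hDKT : K \\ K ⊆ T \\ T := diffs_subset (subset_insert m K) (subset_insert m K)
  -- every member of `T` lies inside `m`
  have hTm : ∀ t ∈ T, t ⊆ m := by
    intro t ht
    have h1 : t ∪ R ∈ T :=
      union_Rstar_mem_of_sdiff_mem hT (subset_refl R) (mem_diffs.2 ⟨t, ht, R, hRT, rfl⟩)
    rcases mem_insert.1 h1 with h | h
    · rw [← h]
      exact subset_union_left
    · exact absurd subset_union_right (hrow _ h)
  have hKm : ∀ k ∈ K, k ⊆ m := fun k hk => hTm k (mem_insert_of_mem hk)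
  -- the differences of `T` are the sets `m \ t`
  have hDform : ∀ d ∈ T \\ T, ∃ t ∈ T, d = m \ t := by
    intro d hd
    rw [diffs_eq_flip_of_tight hT] at hd
    obtain ⟨t, ht, htd⟩ := mem_flip.1 hd
    refine ⟨t, ht, ?_⟩
    rw [← htd, ← hR, hRm, symmDiff_eq_sdiff_of_subset (hTm t ht)]
  have hDm : ∀ d ∈ T \\ T, d ⊆ m := by
    intro d hd
    obtain ⟨t, -, rfl⟩ := hDform d hd
    exact sdiff_subset
  -- `P₁`-eligible sets lie inside `m`
  have hsubm : ∀ p, (∀ k ∈ K, p \ k ∈ K \\ K) → p ⊆ m := by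
    intro p hp x hx
    obtain ⟨k, hk⟩ := hne
    by_cases hxk : x ∈ k
    · exact hKm k hk hxk
    · exact hDm _ (hDKT (hp k hk)) (mem_sdiff.2 ⟨hx, hxk⟩)
  -- twin-freeness of `K` and `T` on their supports
  have hKtf : ∀ a b, (∃ k ∈ K, a ∈ k) → (∃ k ∈ K, a ∉ k) → (∃ k ∈ K, b ∈ k) →
      (∃ k ∈ K, b ∉ k) → Twin K a b → a = b :=
    fun a b ha ha' _ _ hab => eq_of_twin_of_cover htf hcov hab ha ha'
  have hTtf := twinFree_support_insert_of_ext hm1 hm0 hne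
    fun a b ha ha' hab => eq_of_twin_of_cover htf hcov hab ha ha'
  -- co-singletons of `m` at elements outside the core of `K` are members of `K` (MaxErase)
  have hmaxT : ∀ A ∈ T, m ⊆ A → A = m := fun A hA h => Subset.antisymm (hTm A hA) h
  have herase : ∀ g ∈ m, (∃ k ∈ K, g ∉ k) → m.erase g ∈ K := by
    intro g hg hgout
    obtain ⟨k, hk, hgk⟩ := hgout
    have hcls : cls T g = {g} :=
      cls_eq_singleton_of_twinFree_support hTtf ⟨m, hmT, hg⟩ ⟨k, mem_insert_of_mem hk, hgk⟩
    have h1 := erase_mem_of_tight_of_maximal hT hmT hmaxT hg hcls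
      ⟨k, mem_insert_of_mem hk, hgk⟩
    rcases mem_insert.1 h1 with h | h
    · exfalso
      have h2 : g ∉ m.erase g := notMem_erase g m
      rw [h] at h2
      exact h2 hg
    · exact h
  -- members of `P` not inside `m` are `P₀`-eligible
  have hout0 : ∀ p₁ ∈ P, ¬ p₁ ⊆ m → ∀ k ∈ K, k \ p₁ ∈ K \\ K := by
    intro p₁ hp₁ hnsub
    have hp₁K : p₁ ∉ K := fun h => hnsub (hKm p₁ h)
    rcases hcov p₁ hp₁ hp₁K with h | h
    · exact absurd (hsubm p₁ h) hnsub
    · exact h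
  -- hence they contain the core of `K`
  have hcore_sub : ∀ a, (∀ k ∈ K, a ∈ k) → ∀ p₁ ∈ P, ¬ p₁ ⊆ m → a ∈ p₁ := by
    intro a ha p₁ hp₁ hnsub
    by_contra has
    obtain ⟨k, hk⟩ := hne
    obtain ⟨k₁, hk₁, k₂, hk₂, h⟩ := mem_diffs.1 (hout0 p₁ hp₁ hnsub k hk)
    have : a ∈ k \ p₁ := mem_sdiff.2 ⟨ha k hk, has⟩
    rw [← h] at this
    exact (mem_sdiff.1 this).2 (ha k₂ hk₂)
  -- an element `a ∉ m` of a member of `P`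
  obtain ⟨p₁, hp₁, hp₁m⟩ := hmax m hmP
  obtain ⟨a, hap₁, ham⟩ := not_subset.1 hp₁m
  have hain : ∃ p ∈ P, a ∈ p := ⟨p₁, hp₁, hap₁⟩
  have haout : ∃ p ∈ P, a ∉ p := ⟨m, hmP, ham⟩
  -- the core of `K` is contained in the core of `P`
  have hcoreP : ∀ b, (∀ k ∈ K, b ∈ k) → ∀ p ∈ P, b ∈ p := by
    intro b hb p hp
    by_contra hbp
    obtain ⟨k₀, hk₀⟩ := hne
    have hba : b ≠ a := fun h => ham (hKm k₀ hk₀ (h ▸ hb k₀ hk₀))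
    obtain ⟨p', hp', hap', hbp'⟩ := exists_mem_notMem_of_ne hP htf hain haout ⟨p, hp, hbp⟩ hba
    exact hbp' (hcore_sub b hb p' hp' fun h => ham (h hap'))
  -- `T` is up-closed inside `m` on members of `P`
  have hconv : ∀ t ∈ T, ∀ q ∈ P, t ⊆ q → q ⊆ m → q ∈ T := by
    intro t ht q hq htq hqm
    refine mem_of_subset_of_subset_of_twinClosed_of_tight hT ht hmT htq hqm ?_
    intro x y hxy hx
    by_cases hxout : ∃ t' ∈ T, x ∉ t'
    · rw [← hTtf x y ⟨m, hmT, hqm hx⟩ hxout hxy]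
      exact hx
    · push Not at hxout
      have hy : ∀ k ∈ K, y ∈ k := fun k hk => (hxy k (mem_insert_of_mem hk)).1 (hxout k (mem_insert_of_mem hk))
      exact hcoreP y hy q hq
  -- the main argument
  intro p hp hpK hp1
  have hpm : p ⊆ m := hsubm p hp1
  by_contra hpne
  have hpT : p ∉ T := by
    intro h
    rcases mem_insert.1 h with h' | h'
    · exact hpne h'
    · exact hpK h'
  -- the difference of `m.erase e` against a member not inside `m` recovers a member of `T`
  have hkey : ∀ q' ∈ P, ¬ q' ⊆ m → ∀ e ∈ m, (∃ k ∈ K, e ∉ k) →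
      insert e (q' ∩ m) ∈ T := by
    intro q' hq' hq'm e he heout
    have hke : m.erase e ∈ K := herase e he heout
    obtain ⟨t, ht, htd⟩ := hDform _ (hDKT (hout0 q' hq' hq'm _ hke))
    have e1 : t = insert e (q' ∩ m) := by
      ext x
      constructor
      · intro hx
        have hxm : x ∈ m := hTm t ht hx
        by_cases hxe : x = e
        · exact mem_insert.2 (Or.inl hxe)
        · refine mem_insert.2 (Or.inr (mem_inter.2 ⟨?_, hxm⟩))
          by_contra hxq
          have h2 : x ∈ m.erase e \ q' := mem_sdiff.2 ⟨mem_erase.2 ⟨hxe, hxm⟩, hxq⟩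
          rw [htd] at h2
          exact (mem_sdiff.1 h2).2 hx
      · intro hx
        rcases mem_insert.1 hx with rfl | hx'
        · by_contra hxt
          have h2 : x ∈ m \ t := mem_sdiff.2 ⟨he, hxt⟩
          rw [← htd] at h2
          exact (mem_erase.1 (mem_sdiff.1 h2).1).1 rfl
        · obtain ⟨hxq, hxm⟩ := mem_inter.1 hx'
          by_contra hxt
          have h2 : x ∈ m \ t := mem_sdiff.2 ⟨hxm, hxt⟩
          rw [← htd] at h2
          exact (mem_sdiff.1 h2).2 hxq
    rw [← e1]
    exact ht
  -- the core of `K` equals the core of `P`, so an element outside the core of `P` is outside the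
  -- core of `K`
  have hnotcore : ∀ e, (∃ p' ∈ P, e ∉ p') → ∃ k ∈ K, e ∉ k := by
    intro e he
    by_contra h
    push Not at h
    obtain ⟨p', hp', hep'⟩ := he
    exact hep' (hcoreP e h p' hp')
  have hcls : cls P a = {a} := cls_eq_singleton_of_twinFree htf a
  rcases dichotomy_of_tight hP a with hadd | hrem
  · -- `a` addable: `p ∪ {a}` is a member not inside `m`
    rw [hcls] at hadd
    have hq' : p ∪ {a} ∈ P := hadd p hp
    have hq'm : ¬ p ∪ {a} ⊆ m := fun h => ham (h (mem_union_right _ (mem_singleton_self a)))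
    -- an element `e ∈ p` outside the core of `P`
    obtain ⟨p'', hp'', hpp''⟩ := hmin p hp
    obtain ⟨e, hep, hep''⟩ := not_subset.1 hpp''
    have h1 := hkey _ hq' hq'm e (hpm hep) (hnotcore e ⟨p'', hp'', hep''⟩)
    have e2 : insert e ((p ∪ {a}) ∩ m) = p := by
      ext x
      simp only [mem_insert, mem_inter, mem_union, mem_singleton]
      constructor
      · rintro (rfl | ⟨hx | rfl, hxm⟩)
        · exact hep
        · exact hx
        · exact absurd hxm ham
      · intro hx
        exact Or.inr ⟨Or.inl hx, hpm hx⟩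
    rw [e2] at h1
    exact hpT h1
  · -- `a` removable: `{a} ∪ (p ∩ Rstar P)` is a member not inside `m`
    have haR : a ∉ Rstar P := by
      intro h
      rw [mem_Rstar, hcls] at h
      -- both addable and removable: treat as addable
      have hq' : p ∪ {a} ∈ P := h p hp
      have hq'm : ¬ p ∪ {a} ⊆ m := fun h' => ham (h' (mem_union_right _ (mem_singleton_self a)))
      obtain ⟨p'', hp'', hpp''⟩ := hmin p hp
      obtain ⟨e, hep, hep''⟩ := not_subset.1 hpp''
      have h1 := hkey _ hq' hq'm e (hpm hep) (hnotcore e ⟨p'', hp'', hep''⟩)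
      have e2 : insert e ((p ∪ {a}) ∩ m) = p := by
        ext x
        simp only [mem_insert, mem_inter, mem_union, mem_singleton]
        constructor
        · rintro (rfl | ⟨hx | rfl, hxm⟩)
          · exact hep
          · exact hx
          · exact absurd hxm ham
        · intro hx
          exact Or.inr ⟨Or.inl hx, hpm hx⟩
      rw [e2] at h1
      exact hpT h1
    have hq' : {a} ∪ (p ∩ Rstar P) ∈ P := singleton_union_inter_Rstar_mem hP htf hain haout haR hp
    have hq'm : ¬ {a} ∪ (p ∩ Rstar P) ⊆ m := fun h => ham (h (mem_union_left _ (mem_singleton_self a)))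
    obtain ⟨e, he, hecore⟩ := exists_mem_inter_Rstar_notMem_core hP hmin hp
    have hem : e ∈ m := hpm (mem_inter.1 he).1
    have h1 := hkey _ hq' hq'm e hem (hnotcore e hecore)
    have e2 : insert e (({a} ∪ (p ∩ Rstar P)) ∩ m) = p ∩ Rstar P := by
      ext x
      simp only [mem_insert, mem_inter, mem_union, mem_singleton]
      constructor
      · rintro (rfl | ⟨rfl | hx, hxm⟩)
        · exact mem_inter.1 he
        · exact absurd hxm ham
        · exact hx
      · intro hx
        exact Or.inr ⟨Or.inr hx, hpm hx.1⟩
    rw [e2] at h1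
    exact hpT (hconv _ h1 p hp inter_subset_left hpm)

end PercRepro.MSTight
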